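import Mathlib.Analysis.SpecialFunctions.Pow.Real
import Mathlib.Analysis.SpecialFunctions.Sqrt
import Literature.Geometry.Lorentzian.TeukolskyRadialFluxKernel
import HarnessLib

/-!
# Flux pairing of the Wronskian with the product of two solutions (pointwise algebra)

Topic `Literature/Analysis/ODE` (namespace `Literature.Analysis.ODE`). For a REAL second-order equation
`y″ = q(x) y` and a complex solution `u`, the flux `F[u] = Im(ū u′)` is constant. For two solutions `u, v`
with Wronskian `W = u v′ − v u′` one has, at every point, the identity

  `Im(conj(u v) · W) = |u|² · Im(v̄ v′) − |v|² · Im(ū u′)`.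

When the two fluxes have OPPOSITE signs, `Im(ū u′) = −σ`, `Im(v̄ v′) = ω` with `σ, ω ≥ 0` (the
horizon-normalised and the infinity-normalised solutions of a radial wave equation at a non-superradiant
frequency), the right side is `ω|u|² + σ|v|² ≥ 0` and is bounded by `|u|·|v|·|W|`; hence each factor of the
diagonal Green kernel `u v / W` is controlled by the OTHER one, and `|W| ≥ 2√(ωσ)`:

* the identity is `Literature.Geometry.Lorentzian.Kerr.Costa2019.im_conj_mul_det` (landed with the Kerr
  flux layer; imported, not restated);
* `pairing_le` — `ω‖u‖² + σ‖v‖² ≤ ‖u‖‖v‖‖W‖`;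
* `mul_norm_le_of_pairing_left` / `…_right` — `ω‖u‖ ≤ ‖v‖‖W‖`, `σ‖v‖ ≤ ‖u‖‖W‖`;
* `norm_sq_le_of_pairing_left` / `…_right` — the squared forms `‖u‖² ≤ (‖W‖²/ω²)‖v‖²`,
  `‖v‖² ≤ (‖W‖²/σ²)‖u‖²`;
* `two_mul_sqrt_le_norm_wronskian` — `2√(ωσ) ≤ ‖W‖` (both solutions non-zero at the point, which
  `ne_zero_of_im_conj_mul_ne_zero` gives from a non-zero flux).

Everything is one-point algebra (no ODE is used); the constancy of fluxes and of `W` is what makes these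
pointwise facts global in the applications (near-extremal Kerr cone kernel bound, flux regime).

## References
* R. Teixeira da Costa, Commun. Math. Phys. 378 (2020), Prop. 2.20 (fluxes of the normalised pair);
  M. Dafermos, I. Rodnianski, Y. Shlapentokh-Rothman, arXiv:1402.7034, §7.2. The algebra is folklore.
-/

noncomputable section

open scoped ComplexConjugate

namespace Literature.Analysis.ODE

/-- A non-zero flux forces the solution to be non-zero at the point: `Im(ū u′) ≠ 0 → u ≠ 0`. [folklore] -/
theorem ne_zero_of_im_conj_mul_ne_zero {u u' : ℂ} (h : (conj u * u').im ≠ 0) : u ≠ 0 := by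
  rintro rfl
  simp at h

/-- **The pairing inequality**: if `Im(ū u′) = −σ` and `Im(v̄ v′) = ω`, then
`ω‖u‖² + σ‖v‖² ≤ ‖u‖·‖v‖·‖u v′ − v u′‖` (`Im z ≤ |z|`). [folklore] -/
theorem pairing_le {u u' v v' : ℂ} {σ ω : ℝ} (hu : (conj u * u').im = -σ) (hv : (conj v * v').im = ω) :
    ω * ‖u‖ ^ 2 + σ * ‖v‖ ^ 2 ≤ ‖u‖ * ‖v‖ * ‖u * v' - v * u'‖ := by
  have hid := Literature.Geometry.Lorentzian.Kerr.Costa2019.im_conj_mul_det u u' v v'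
  rw [hu, hv] at hid
  have hle : (conj (u * v) * (u * v' - v * u')).im ≤ ‖conj (u * v) * (u * v' - v * u')‖ :=
    Complex.im_le_norm _
  rw [hid, norm_mul, Complex.norm_conj, norm_mul] at hle
  linarith

/-- `ω‖u‖ ≤ ‖v‖·‖W‖` when `σ ≥ 0` (the `u`-factor of the diagonal kernel is controlled by the
`v`-factor). [folklore] -/
theorem mul_norm_le_of_pairing_left {u u' v v' : ℂ} {σ ω : ℝ} (hu : (conj u * u').im = -σ)
    (hv : (conj v * v').im = ω) (hσ : 0 ≤ σ) :
    ω * ‖u‖ ≤ ‖v‖ * ‖u * v' - v * u'‖ := by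
  have hp := pairing_le hu hv
  have h1 : ω * ‖u‖ ^ 2 ≤ ‖u‖ * (‖v‖ * ‖u * v' - v * u'‖) := by
    nlinarith [norm_nonneg v, mul_nonneg hσ (sq_nonneg ‖v‖)]
  rcases (norm_nonneg u).eq_or_lt with h0 | hpos
  · rw [← h0]; simp; positivity
  · have : ω * ‖u‖ * ‖u‖ ≤ (‖v‖ * ‖u * v' - v * u'‖) * ‖u‖ := by nlinarith
    exact le_of_mul_le_mul_right this hpos

/-- `σ‖v‖ ≤ ‖u‖·‖W‖` when `ω ≥ 0`. [folklore] -/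
theorem mul_norm_le_of_pairing_right {u u' v v' : ℂ} {σ ω : ℝ} (hu : (conj u * u').im = -σ)
    (hv : (conj v * v').im = ω) (hω : 0 ≤ ω) :
    σ * ‖v‖ ≤ ‖u‖ * ‖u * v' - v * u'‖ := by
  have hp := pairing_le hu hv
  have h1 : σ * ‖v‖ ^ 2 ≤ ‖v‖ * (‖u‖ * ‖u * v' - v * u'‖) := by
    nlinarith [norm_nonneg u, mul_nonneg hω (sq_nonneg ‖u‖)]
  rcases (norm_nonneg v).eq_or_lt with h0 | hpos
  · rw [← h0]; simp; positivity
  · have : σ * ‖v‖ * ‖v‖ ≤ (‖u‖ * ‖u * v' - v * u'‖) * ‖v‖ := by nlinarith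
    exact le_of_mul_le_mul_right this hpos

/-- Squared form: `‖u‖² ≤ (‖W‖²/ω²)·‖v‖²` when `ω > 0`, `σ ≥ 0`. [folklore] -/
theorem norm_sq_le_of_pairing_left {u u' v v' : ℂ} {σ ω : ℝ} (hu : (conj u * u').im = -σ)
    (hv : (conj v * v').im = ω) (hω : 0 < ω) (hσ : 0 ≤ σ) :
    ‖u‖ ^ 2 ≤ ‖u * v' - v * u'‖ ^ 2 / ω ^ 2 * ‖v‖ ^ 2 := by
  have h := mul_norm_le_of_pairing_left hu hv hσ
  have h2 : (ω * ‖u‖) ^ 2 ≤ (‖v‖ * ‖u * v' - v * u'‖) ^ 2 :=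
    pow_le_pow_left₀ (by positivity) h 2
  rw [div_mul_eq_mul_div, le_div_iff₀ (by positivity)]
  nlinarith

/-- Squared form: `‖v‖² ≤ (‖W‖²/σ²)·‖u‖²` when `σ > 0`, `ω ≥ 0`. [folklore] -/
theorem norm_sq_le_of_pairing_right {u u' v v' : ℂ} {σ ω : ℝ} (hu : (conj u * u').im = -σ)
    (hv : (conj v * v').im = ω) (hσ : 0 < σ) (hω : 0 ≤ ω) :
    ‖v‖ ^ 2 ≤ ‖u * v' - v * u'‖ ^ 2 / σ ^ 2 * ‖u‖ ^ 2 := by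
  have h := mul_norm_le_of_pairing_right hu hv hω
  have h2 : (σ * ‖v‖) ^ 2 ≤ (‖u‖ * ‖u * v' - v * u'‖) ^ 2 :=
    pow_le_pow_left₀ (by positivity) h 2
  rw [div_mul_eq_mul_div, le_div_iff₀ (by positivity)]
  nlinarith

/-- **Wronskian floor `2√(ωσ) ≤ ‖W‖`** for opposite-sign fluxes `Im(ū u′) = −σ < 0 < ω = Im(v̄ v′)`
(AM–GM in the pairing inequality; both `u, v ≠ 0` at the point because their fluxes are non-zero).
[folklore] -/
theorem two_mul_sqrt_le_norm_wronskian {u u' v v' : ℂ} {σ ω : ℝ} (hu : (conj u * u').im = -σ)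
    (hv : (conj v * v').im = ω) (hσ : 0 < σ) (hω : 0 < ω) :
    2 * Real.sqrt (ω * σ) ≤ ‖u * v' - v * u'‖ := by
  have hp := pairing_le hu hv
  have hu0 : u ≠ 0 := ne_zero_of_im_conj_mul_ne_zero (by rw [hu]; exact neg_ne_zero.2 hσ.ne')
  have hv0 : v ≠ 0 := ne_zero_of_im_conj_mul_ne_zero (by rw [hv]; exact hω.ne')
  have hnu : 0 < ‖u‖ := norm_pos_iff.2 hu0
  have hnv : 0 < ‖v‖ := norm_pos_iff.2 hv0
  set W := ‖u * v' - v * u'‖ with hW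
  -- AM–GM: `2√(ωσ)‖u‖‖v‖ ≤ ω‖u‖² + σ‖v‖²`
  have hamgm : 2 * Real.sqrt (ω * σ) * (‖u‖ * ‖v‖) ≤ ω * ‖u‖ ^ 2 + σ * ‖v‖ ^ 2 := by
    have e1 : Real.sqrt (ω * σ) = Real.sqrt ω * Real.sqrt σ := Real.sqrt_mul hω.le σ
    have e2 : ω = Real.sqrt ω ^ 2 := (Real.sq_sqrt hω.le).symm
    have e3 : σ = Real.sqrt σ ^ 2 := (Real.sq_sqrt hσ.le).symm
    have key : 0 ≤ (Real.sqrt ω * ‖u‖ - Real.sqrt σ * ‖v‖) ^ 2 := sq_nonneg _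
    calc 2 * Real.sqrt (ω * σ) * (‖u‖ * ‖v‖)
        = 2 * (Real.sqrt ω * ‖u‖) * (Real.sqrt σ * ‖v‖) := by rw [e1]; ring
      _ ≤ (Real.sqrt ω * ‖u‖) ^ 2 + (Real.sqrt σ * ‖v‖) ^ 2 := by nlinarith [key]
      _ = ω * ‖u‖ ^ 2 + σ * ‖v‖ ^ 2 := by
          conv_rhs => rw [e2, e3]
          ring
  have hprod : 0 < ‖u‖ * ‖v‖ := mul_pos hnu hnv
  have : 2 * Real.sqrt (ω * σ) * (‖u‖ * ‖v‖) ≤ W * (‖u‖ * ‖v‖) := by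
    calc _ ≤ ω * ‖u‖ ^ 2 + σ * ‖v‖ ^ 2 := hamgm
      _ ≤ ‖u‖ * ‖v‖ * W := hp
      _ = W * (‖u‖ * ‖v‖) := by ring
  exact le_of_mul_le_mul_right this hprod

/-- Consequence used for "one point on each side of the barrier": with the floor,
`‖u‖·‖v‖ ≤ ‖u‖‖v‖·‖W‖/(2√(ωσ))`, i.e. any bound `P` on the product becomes `P·‖W‖/(2√(ωσ))`. [folklore] -/
theorem le_mul_norm_wronskian_div {u u' v v' : ℂ} {σ ω P : ℝ} (hu : (conj u * u').im = -σ)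
    (hv : (conj v * v').im = ω) (hσ : 0 < σ) (hω : 0 < ω) (hP : 0 ≤ P) :
    P ≤ P * ‖u * v' - v * u'‖ / (2 * Real.sqrt (ω * σ)) := by
  have h := two_mul_sqrt_le_norm_wronskian hu hv hσ hω
  have hs : 0 < 2 * Real.sqrt (ω * σ) := by positivity
  rw [le_div_iff₀ hs]
  nlinarith

end Literature.Analysis.ODE

end
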